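import Summits.AtomisticToContinuum.Crystallization.Theorems.FrustratedLawDichotomyStrainedPatchChartFamiliesBent

/-!
# The bent line PINNED: bending class `𝓑₀`, refit envelope engine, phase-aware tables `Φ₀`, root law `T₀`, edge level `η_E` («ChartFamiliesPinned», lens-5 g52)

Lens-5 («finite / base range + asymptotic regime + bridge») node under «ChartFamilies» (g51, split into `…ChartFamilies` §§1–2 and `…ChartFamiliesBent`
§§3–5) on the 27623 T-side piece `StrainedPatchRec`.  TARGET OF RECORD: `CoreOffTubeFloor (63/10) (63/10) (24/5) (1/100) 0` **[CORE-FAR]**; residual of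
record `SoftFarFloor (63/10) (63/10) (24/5) (1/100) (1/10) 0` **[SOFT-FAR]**.  This node fixes the triple the critic asked for (ROW 900): the bending class
`𝓑₀`, the envelope modulus `Φ₀` and the room law `T₀` — with NUMBERS — and posts the instantiated decls (F1/F2/F3)-bent₀, twice: once on g51's plain-chart
engine (§4, LINE B) and once on the REFIT engine typed in §2 (LINE A, the line of record), together with the edge level each engine certifies at first order.

§1 `polyBends q₂ q₃` / `bends0 := polyBends (1/200) (1/2000)` — near-identity polynomial maps `v ↦ v + Q v v + C v v v` of degree ≤ 3 with pointwise bounds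
`‖Q u v‖ ≤ q₂‖u‖‖v‖`, `‖C u v w‖ ≤ q₃‖u‖‖v‖‖w‖` (27 + 81 real parameters, 18 + 30 effective); `id ∈ polyBends`, monotone in the bounds, displacement `‖b v − v‖ ≤ q₂‖v‖² + q₃‖v‖³`.
The bounds CONTAIN every lattice-equilibrated quadratic + cubic bending that passes the force cap (memo BEND51: rim strain `q ≤ q_F ≈ 0.025`, i.e. `‖Q‖ ≲ 2.3e-3`,
`‖C‖ ≲ 3e-4`) with a factor-2 margin; equilibration and the cap are NOT encoded in the class — `Admissible` inside `bentFamily` removes the other members, so the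
margin costs (F1)/(F3) nothing.

§2 THE REFIT ENGINE (the typed form of memo FLAG-4, the affine quotient; TWO families: charts `𝓘₀`, comparison instances `𝓘₁ ⊇ 𝓘₀`).  Finding of this
generation (instrument FITDUAL52, memo §3): in SUP-NORM chart currency the affine part of an adversarial boundary pattern cannot be discounted by re-measuring
the deviation from a core-fitted chart — the fitted-chart dual table is `ℓ* = (0.95…1.04)·‖g_na‖₁` but the fitted deviation of a window pattern of raw amplitude
`a` is up to `(1.5…2.3)·a`, and the product is the RAW table again.  What DOES bank the quotient is to keep the chart (and its raw deviation `t`) and move the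
affine part into the COMPARISON INSTANCE: (F1ʳ) `FamilyEnvelopeRefit 𝓘₀ 𝓘₁ τ κN Φ` — a cluster charted by `z₀ ∈ 𝓘₀` at fine deviation `t` scores at least
`S(z₁) − Φ(z₀)(t)` for SOME `z₁ ∈ 𝓘₁` whose fit level is within `κN·t` of `z₀`'s (`LevelNear`); (F3ʳ) `FamilyCertRefit 𝓘₀ 𝓘₁ κN φ Φ T` — the certificate over
such PAIRS (its adverse side, `z₁` BELOW `z₀`, is the price `κN·T·|dS/dη|` of the quotient); SEAM (F1ʳ) ∧ (F2 on `𝓘₀`) ∧ (F3ʳ) ⟹ `EdgeFarFloor (63/10) (63/10) ρ ε η₂ φ`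
with g51's (F2) `FamilyRoom` unchanged.  Trades (`𝓘₀ ≤ 𝓘₁`, `κN ≥ 0`): (F1) ⟹ (F1ʳ) and (F3ʳ) ⟹ (F3): the refit line is envelope-easier and certificate-harder.

§3 PINS (phase-aware level tables, selector `FccGoodAtScale (1/8) (3/2)` at the instance's centre, argument `x = fitLevel − 1/20`, quadratic envelopes with
≥ 5 % headroom over the eleven hosts of the census with level ≤ 0.09; memo TABLES52 / BUDGET52): roughness `ℓ₀` (charted shell `23/4 < r ≤ 63/10`), exterior
`ℓx₀` (`r > 63/10`, uncharted, booked in the `t`-independent column at the law's own amplitude — hypothesis (H-ext) of the memo), force slack `sw₀` (= `s·σ₁`),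
curvature `q₀ = 1/4`, second-order exterior `B₀ = 1/10000`; law `T₀ := rootLaw 1 0 (3/10) = windowRoom + (3/10)σ₁` (`κ = 1` is the hypothesis of record; reach
`η_e(κ)` in the memo); coarse tolerance `τ₀ = 1/4`; refit constant `κN₀ = 1/4`; LINE A: chart family cap `η₀₀ = 1/16`, comparison family cap `η₃₀ = 7/100`, edge
level `η_E = 3/50`; LINE B: family cap `η₃₀' = 11/200`, edge level `η_E' = 21/400`.  Budget at the pins (tables / measured columns, `κ = 1`, worst case = the
certificate at the chart-family cap, adverse pair included): LINE A hcp `+16.8 % / +21.0 %` of `S_hom(1/16)`, fcc `+30.5 % / +33.8 %`, before a bent-instance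
relief of at most ≈ 6 %; LINE B hcp `+6.8 % / +11.8 %` of `S_hom(11/200)`.  Engine-limited reach (margin 0, tables): LINE A hcp `0.0715` / fcc `0.083`; LINE B
hcp `0.0575` / fcc `0.078`; at `κ = 3/2`: `0.061 / 0.065` resp. `0.0535 / 0.0625`.

§4 THE DECLS AND NODES.  LINE A (of record): `FamilyEnvelopeBent0 → FamilyRoomBent0 → FamilyCertBent0 → EdgeFarFloor (63/10) (63/10) (24/5) (1/100) (3/50) 0`,
and with `BandFarFloor … (3/50) (1/10) 0` **[BRIDGE band, undecided]** and the [SOFT-FAR] residual of record ⟹ `CoreOffTubeFloor (63/10) (63/10) (24/5) (1/100) 0`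
⟹ (tree record assembly) `StrainedPatchRec`.  LINE B (plain g51 decls, raw tables): the same at `η_E' = 21/400`.  Lean proves only the bookkeeping; every
number above is a census pin whose evidence is the memo, not a theorem.  No new axioms, no cite tokens, no instances / notation.
-/

namespace Summit.AtomisticToContinuum.Crystallization.Theorems.FrustratedLawDichotomyStrainedPatchChartFamiliesPinned

open scoped BigOperators Classical
open Summit.AtomisticToContinuum.Crystallization.Theorems.FrustratedLawDichotomyMotifLemmas
open Summit.AtomisticToContinuum.Crystallization.Theorems.FrustratedLawDichotomyAveragingCut
open Summit.AtomisticToContinuum.Crystallization.Theorems.FrustratedLawDichotomyAveragingRuleCap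
open Summit.AtomisticToContinuum.Crystallization.Theorems.FrustratedLawDichotomyAveragingRuleTightFree
open Summit.AtomisticToContinuum.Crystallization.Theorems.FrustratedLawDichotomyExemptDoor (SitePred)
open Summit.AtomisticToContinuum.Crystallization.Theorems.FrustratedLawDichotomyExemptAbsorption
open Summit.AtomisticToContinuum.Crystallization.Theorems.FrustratedLawDichotomyExemptAbsorptionRecord
open Summit.AtomisticToContinuum.Crystallization.Theorems.FrustratedLawDichotomyCollarCensus
open Summit.AtomisticToContinuum.Crystallization.Theorems.FrustratedLawDichotomyCollarCensusKappa
open Summit.AtomisticToContinuum.Crystallization.Theorems.FrustratedLawDichotomyStrainedPatchHomSplit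
open Summit.AtomisticToContinuum.Crystallization.Theorems.FrustratedLawDichotomyStrainedPatchCleanCollar
open Summit.AtomisticToContinuum.Crystallization.Theorems.FrustratedLawDichotomyStrainedPatchHomTube
open Summit.AtomisticToContinuum.Crystallization.Theorems.FrustratedLawDichotomyStrainedPatchHomIsometry
open Summit.AtomisticToContinuum.Crystallization.Theorems.FrustratedLawDichotomyStrainedPatchHomTubeIso
open Summit.AtomisticToContinuum.Crystallization.Theorems.FrustratedLawDichotomyStrainedPatchPhaseCut
open Summit.AtomisticToContinuum.Crystallization.Theorems.FrustratedLawDichotomyStrainedPatchCoreTube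
open Summit.AtomisticToContinuum.Crystallization.Theorems.FrustratedLawDichotomyStrainedPatchCoreTubeRecord
open Summit.AtomisticToContinuum.Crystallization.Theorems.FrustratedLawDichotomyStrainedPatchCoreTubeMilli
open Summit.AtomisticToContinuum.Crystallization.Theorems.FrustratedLawDichotomyStrainedPatchStrainBands
open Summit.AtomisticToContinuum.Crystallization.Theorems.FrustratedLawDichotomyStrainedPatchChartFamilies
open Summit.AtomisticToContinuum.Crystallization.Theorems.FrustratedLawDichotomyStrainedPatchChartFamiliesBent

/-! ## §1. The bending class of record `𝓑₀` -/

/-- **`polyBends q₂ q₃`** — near-identity polynomial maps of degree ≤ 3 about the centre: `b v = v + Q v v + C v v v` with a bilinear `Q` and a trilinear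
`C` (plain multilinear maps on `E3`, automatically continuous) bounded pointwise by `q₂` and `q₃`: `‖Q u v‖ ≤ q₂‖u‖‖v‖`, `‖C u v w‖ ≤ q₃‖u‖‖v‖‖w‖`. -/
def polyBends (q₂ q₃ : ℝ) : Set (E3 → E3) :=
  {b | ∃ (Q : E3 →ₗ[ℝ] E3 →ₗ[ℝ] E3) (C : E3 →ₗ[ℝ] E3 →ₗ[ℝ] E3 →ₗ[ℝ] E3), (∀ u v, ‖Q u v‖ ≤ q₂ * ‖u‖ * ‖v‖) ∧
    (∀ u v w, ‖C u v w‖ ≤ q₃ * ‖u‖ * ‖v‖ * ‖w‖) ∧ ∀ v, b v = v + Q v v + C v v v}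

/-- ★ THE BENDING CLASS OF RECORD: quadratic bound `1/200`, cubic bound `1/2000`. -/
def bends0 : Set (E3 → E3) := polyBends (1 / 200) (1 / 2000)

/-- `id ∈ polyBends q₂ q₃` (`Q = C = 0`), so every homogeneous instance is bent and g51's hom ⟹ bent trades apply. [formal bookkeeping] -/
theorem id_mem_polyBends {q₂ q₃ : ℝ} (h₂ : 0 ≤ q₂) (h₃ : 0 ≤ q₃) : id ∈ polyBends q₂ q₃ := by
  refine ⟨0, 0, fun u v => ?_, fun u v w => ?_, fun v => by simp⟩
  · simp only [LinearMap.zero_apply, norm_zero]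
    exact mul_nonneg (mul_nonneg h₂ (norm_nonneg u)) (norm_nonneg v)
  · simp only [LinearMap.zero_apply, norm_zero]
    exact mul_nonneg (mul_nonneg (mul_nonneg h₃ (norm_nonneg u)) (norm_nonneg v)) (norm_nonneg w)

/-- Auxiliary step (`id mem bends0`). [formal bookkeeping] -/
theorem id_mem_bends0 : id ∈ bends0 := id_mem_polyBends (by norm_num) (by norm_num)

/-- The class grows with the bounds. [formal bookkeeping] -/
theorem polyBends_mono {q₂ q₂' q₃ q₃' : ℝ} (h₂ : q₂ ≤ q₂') (h₃ : q₃ ≤ q₃') : polyBends q₂ q₃ ⊆ polyBends q₂' q₃' := by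
  rintro b ⟨Q, C, hQ, hC, hb⟩
  refine ⟨Q, C, fun u v => (hQ u v).trans ?_, fun u v w => (hC u v w).trans ?_, hb⟩
  · exact mul_le_mul_of_nonneg_right (mul_le_mul_of_nonneg_right h₂ (norm_nonneg u)) (norm_nonneg v)
  · exact mul_le_mul_of_nonneg_right (mul_le_mul_of_nonneg_right (mul_le_mul_of_nonneg_right h₃ (norm_nonneg u)) (norm_nonneg v)) (norm_nonneg w)

/-- The displacement of a bending is quadratic + cubic in the distance to the centre: `‖b v − v‖ ≤ q₂‖v‖² + q₃‖v‖³`. [folklore] -/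
theorem polyBends_disp {q₂ q₃ : ℝ} {b : E3 → E3} (hb : b ∈ polyBends q₂ q₃) (v : E3) : ‖b v - v‖ ≤ q₂ * ‖v‖ ^ 2 + q₃ * ‖v‖ ^ 3 := by
  obtain ⟨Q, C, hQ, hC, hbv⟩ := hb
  have h₁ : ‖Q v v‖ ≤ q₂ * ‖v‖ ^ 2 := by nlinarith [hQ v v]
  have h₂ : ‖C v v v‖ ≤ q₃ * ‖v‖ ^ 3 := by nlinarith [hC v v v]
  rw [hbv v, show v + Q v v + C v v v - v = Q v v + C v v v by abel]
  exact (norm_add_le _ _).trans (add_le_add h₁ h₂)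

/-- At the record reach `‖v‖ ≤ 63/10` a bending of record displaces by at most `(1/200)(63/10)² + (1/2000)(63/10)³ < 13/40`. [formal bookkeeping] -/
theorem bends0_disp_le {b : E3 → E3} (hb : b ∈ bends0) {v : E3} (hv : ‖v‖ ≤ 63 / 10) : ‖b v - v‖ ≤ 13 / 40 := by
  have h := polyBends_disp hb v
  have h0 := norm_nonneg v
  have h2 : ‖v‖ ^ 2 ≤ (63 / 10) ^ 2 := by gcongr
  have h3 : ‖v‖ ^ 3 ≤ (63 / 10) ^ 3 := by gcongr
  nlinarith

/-! ## §2. The refit envelope engine (the affine quotient, typed) -/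

/-- **`LevelNear κN t z₀ c₀ z₁ c₁`** — the fit levels of the two instances differ by at most `κN·max t 0`. -/
def LevelNear (κN t : ℝ) {M₀ : ℕ} (z₀ : Fin M₀ → E3) (c₀ : Fin M₀) {M₁ : ℕ} (z₁ : Fin M₁ → E3) (c₁ : Fin M₁) : Prop :=
  |fitLevel z₁ c₁ - fitLevel z₀ c₀| ≤ κN * max t 0

/-- Auxiliary step (`levelNear refl`). [formal bookkeeping] -/
theorem levelNear_refl {κN : ℝ} (hκ : 0 ≤ κN) (t : ℝ) {M₀ : ℕ} (z₀ : Fin M₀ → E3) (c₀ : Fin M₀) : LevelNear κN t z₀ c₀ z₀ c₀ := by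
  simp only [LevelNear, sub_self, abs_zero]
  exact mul_nonneg hκ (le_max_right t 0)

/-- Auxiliary step (`mono`). [formal bookkeeping] -/
theorem LevelNear.mono {κN κN' t : ℝ} {M₀ : ℕ} {z₀ : Fin M₀ → E3} {c₀ : Fin M₀} {M₁ : ℕ} {z₁ : Fin M₁ → E3} {c₁ : Fin M₁}
    (h : LevelNear κN t z₀ c₀ z₁ c₁) (hle : κN ≤ κN') : LevelNear κN' t z₀ c₀ z₁ c₁ :=
  h.trans (mul_le_mul_of_nonneg_right hle (le_max_right t 0))

/-- **(F1ʳ) `FamilyEnvelopeRefit 𝓘₀ 𝓘₁ τ κN Φ` [ANALYTIC]** — every admissible record cluster charted (coarse `τ`, fine `t ≥ 0`) by an instance `z₀` of the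
CHART family `𝓘₀` scores at least `S(z₁) − Φ(z₀)(t)` for SOME instance `z₁` of the COMPARISON family `𝓘₁` with fit level within `κN·t` of `z₀`'s (the REFIT: the
affine part of the deviation goes into the comparison instance; the modulus, priced at the chart with the RAW deviation, pays only for the non-affine part). -/
def FamilyEnvelopeRefit (𝓘₀ 𝓘₁ : (M₀ : ℕ) → (Fin M₀ → E3) → Fin M₀ → Prop) (τ κN : ℝ) (Φ : (M₀ : ℕ) → (Fin M₀ → E3) → Fin M₀ → ℝ → ℝ) : Prop :=
  ∀ (M : ℕ) (z : Fin M → E3) (c : Fin M) (M₀ : ℕ) (z₀ : Fin M₀ → E3) (c₀ : Fin M₀) (e : Fin M → Fin M₀) (t : ℝ),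
    Admissible M z c → CleanBall (63 / 10) z c → MonoPhaseBall (63 / 10) z c → 0 ≤ t → ChartBy 𝓘₀ τ t z c z₀ c₀ e →
      ∃ (M₁ : ℕ) (z₁ : Fin M₁ → E3) (c₁ : Fin M₁), 𝓘₁ M₁ z₁ c₁ ∧ LevelNear κN t z₀ c₀ z₁ c₁ ∧
        ballAvg (9 / 5) z₁ (xRec M₁ z₁) c₁ - Φ M₀ z₀ c₀ t ≤ ballAvg (9 / 5) z (xRec M z) c

/-- **(F3ʳ) `FamilyCertRefit 𝓘₀ 𝓘₁ κN φ Φ T` [CERTIFICATE over PAIRS, INSTRUMENTABLE]** — for every chart instance `z₀ ∈ 𝓘₀` and every comparison instance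
`z₁ ∈ 𝓘₁` with fit level within `κN·T(z₀)` of `z₀`'s: `φ ≤ S(z₁) − Φ(z₀)(T(z₀))`. -/
def FamilyCertRefit (𝓘₀ 𝓘₁ : (M₀ : ℕ) → (Fin M₀ → E3) → Fin M₀ → Prop) (κN φ : ℝ) (Φ : (M₀ : ℕ) → (Fin M₀ → E3) → Fin M₀ → ℝ → ℝ)
    (T : (M₀ : ℕ) → (Fin M₀ → E3) → Fin M₀ → ℝ) : Prop :=
  ∀ (M₀ : ℕ) (z₀ : Fin M₀ → E3) (c₀ : Fin M₀) (M₁ : ℕ) (z₁ : Fin M₁ → E3) (c₁ : Fin M₁), 𝓘₀ M₀ z₀ c₀ → 𝓘₁ M₁ z₁ c₁ →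
    LevelNear κN (T M₀ z₀ c₀) z₀ c₀ z₁ c₁ → φ ≤ ballAvg (9 / 5) z₁ (xRec M₁ z₁) c₁ - Φ M₀ z₀ c₀ (T M₀ z₀ c₀)

/-- ★★ THE REFIT SEAM: (F1ʳ) ∧ (F2 on the chart family) ∧ (F3ʳ) ⟹ `EdgeFarFloor (63/10) (63/10) ρ ε η₂ φ` — chart the rotated cluster (F2), refit (F1ʳ), certify
the pair (F3ʳ); the score is isometry invariant.  Every pair of families, modulus, law and `κN`. [folklore] -/
theorem edgeFar_of_familyRefit {𝓘₀ 𝓘₁ : (M₀ : ℕ) → (Fin M₀ → E3) → Fin M₀ → Prop} {ρ ε η₂ τ κN φ : ℝ} {Φ : (M₀ : ℕ) → (Fin M₀ → E3) → Fin M₀ → ℝ → ℝ}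
    {T : (M₀ : ℕ) → (Fin M₀ → E3) → Fin M₀ → ℝ} (hE : FamilyEnvelopeRefit 𝓘₀ 𝓘₁ τ κN Φ) (hR : FamilyRoom 𝓘₀ ρ ε η₂ τ T)
    (hC : FamilyCertRefit 𝓘₀ 𝓘₁ κN φ Φ T) : EdgeFarFloor (63 / 10) (63 / 10) ρ ε η₂ φ := by
  intro M z c hz hcl hm hn hg
  obtain ⟨R, M₀, z₀, c₀, e, ht, hch⟩ := hR M z c hz hcl hm hn hg
  obtain ⟨M₁, z₁, c₁, hI₁, hN, h₁⟩ := hE M (⇑R ∘ z) c M₀ z₀ c₀ e _ ((admissible_comp_iff R z c).2 hz) ((cleanBall_comp_iff R z c).2 hcl)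
    ((monoPhaseBall_comp_iff R z c).2 hm) ht hch
  rw [ballAvg_xRec_comp] at h₁
  have h₃ := hC M₀ z₀ c₀ M₁ z₁ c₁ hch.1 hI₁ hN
  linarith

/-- ★★ THE REFIT NODE: (F1ʳ) ∧ (F2) ∧ (F3ʳ) ∧ `SoftFarFloor (63/10) (63/10) ρ ε η₂ φ` ⟹ `CoreOffTubeFloor (63/10) (63/10) ρ ε φ`. [folklore] -/
theorem coreOff_of_familyRefit_of_soft {𝓘₀ 𝓘₁ : (M₀ : ℕ) → (Fin M₀ → E3) → Fin M₀ → Prop} {ρ ε η₂ τ κN φ : ℝ}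
    {Φ : (M₀ : ℕ) → (Fin M₀ → E3) → Fin M₀ → ℝ → ℝ} {T : (M₀ : ℕ) → (Fin M₀ → E3) → Fin M₀ → ℝ} (hE : FamilyEnvelopeRefit 𝓘₀ 𝓘₁ τ κN Φ)
    (hR : FamilyRoom 𝓘₀ ρ ε η₂ τ T) (hC : FamilyCertRefit 𝓘₀ 𝓘₁ κN φ Φ T) (hS : SoftFarFloor (63 / 10) (63 / 10) ρ ε η₂ φ) :
    CoreOffTubeFloor (63 / 10) (63 / 10) ρ ε φ :=
  (coreOff_iff_edge_and_soft _ _ ρ ε η₂ φ).2 ⟨edgeFar_of_familyRefit hE hR hC, hS⟩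

/-- ★ THE TRADE, refit vs plain (`𝓘₀ ≤ 𝓘₁`, `κN ≥ 0`): g51's (F1) on the chart family GIVES (F1ʳ) (refit to the chart itself) … [formal bookkeeping] -/
theorem familyEnvelopeRefit_of_familyEnvelope {𝓘₀ 𝓘₁ : (M₀ : ℕ) → (Fin M₀ → E3) → Fin M₀ → Prop} (hI : FamilyLE 𝓘₀ 𝓘₁) {τ κN : ℝ} (hκ : 0 ≤ κN)
    {Φ : (M₀ : ℕ) → (Fin M₀ → E3) → Fin M₀ → ℝ → ℝ} (h : FamilyEnvelope 𝓘₀ τ Φ) : FamilyEnvelopeRefit 𝓘₀ 𝓘₁ τ κN Φ :=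
  fun M z c M₀ z₀ c₀ e t hz hcl hm ht hch => ⟨M₀, z₀, c₀, hI M₀ z₀ c₀ hch.1, levelNear_refl hκ t z₀ c₀, h M z c M₀ z₀ c₀ e t hz hcl hm ht hch⟩

/-- … and (F3ʳ) GIVES g51's (F3) on the chart family (the diagonal pairs). [formal bookkeeping] -/
theorem familyCert_of_familyCertRefit {𝓘₀ 𝓘₁ : (M₀ : ℕ) → (Fin M₀ → E3) → Fin M₀ → Prop} (hI : FamilyLE 𝓘₀ 𝓘₁) {κN φ : ℝ} (hκ : 0 ≤ κN)
    {Φ : (M₀ : ℕ) → (Fin M₀ → E3) → Fin M₀ → ℝ → ℝ} {T : (M₀ : ℕ) → (Fin M₀ → E3) → Fin M₀ → ℝ} (h : FamilyCertRefit 𝓘₀ 𝓘₁ κN φ Φ T) :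
    FamilyCert 𝓘₀ φ Φ T :=
  fun M₀ z₀ c₀ hI₀ => h M₀ z₀ c₀ M₀ z₀ c₀ hI₀ (hI M₀ z₀ c₀ hI₀) (levelNear_refl hκ _ z₀ c₀)

/-- (F1ʳ) is monotone in `κN`, in the comparison family and in the modulus; (F3ʳ) antitone in `κN`, in both families and in `φ`. [formal bookkeeping] -/
theorem FamilyEnvelopeRefit.mono_near {𝓘₀ 𝓘₁ : (M₀ : ℕ) → (Fin M₀ → E3) → Fin M₀ → Prop} {τ κN κN' : ℝ} {Φ : (M₀ : ℕ) → (Fin M₀ → E3) → Fin M₀ → ℝ → ℝ}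
    (h : FamilyEnvelopeRefit 𝓘₀ 𝓘₁ τ κN Φ) (hle : κN ≤ κN') : FamilyEnvelopeRefit 𝓘₀ 𝓘₁ τ κN' Φ := by
  intro M z c M₀ z₀ c₀ e t hz hcl hm ht hch
  obtain ⟨M₁, z₁, c₁, hI₁, hN, h₁⟩ := h M z c M₀ z₀ c₀ e t hz hcl hm ht hch
  exact ⟨M₁, z₁, c₁, hI₁, hN.mono hle, h₁⟩

/-- Auxiliary step (`mono target`). [formal bookkeeping] -/
theorem FamilyEnvelopeRefit.mono_target {𝓘₀ 𝓘₁ 𝓘₁' : (M₀ : ℕ) → (Fin M₀ → E3) → Fin M₀ → Prop} {τ κN : ℝ} {Φ : (M₀ : ℕ) → (Fin M₀ → E3) → Fin M₀ → ℝ → ℝ}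
    (h : FamilyEnvelopeRefit 𝓘₀ 𝓘₁ τ κN Φ) (hle : FamilyLE 𝓘₁ 𝓘₁') : FamilyEnvelopeRefit 𝓘₀ 𝓘₁' τ κN Φ := by
  intro M z c M₀ z₀ c₀ e t hz hcl hm ht hch
  obtain ⟨M₁, z₁, c₁, hI₁, hN, h₁⟩ := h M z c M₀ z₀ c₀ e t hz hcl hm ht hch
  exact ⟨M₁, z₁, c₁, hle M₁ z₁ c₁ hI₁, hN, h₁⟩

/-- Auxiliary step (`mono modulus`). [formal bookkeeping] -/
theorem FamilyEnvelopeRefit.mono_modulus {𝓘₀ 𝓘₁ : (M₀ : ℕ) → (Fin M₀ → E3) → Fin M₀ → Prop} {τ κN : ℝ} {Φ Φ' : (M₀ : ℕ) → (Fin M₀ → E3) → Fin M₀ → ℝ → ℝ}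
    (h : FamilyEnvelopeRefit 𝓘₀ 𝓘₁ τ κN Φ) (hle : ∀ (M₀ : ℕ) (z₀ : Fin M₀ → E3) (c₀ : Fin M₀) (t : ℝ), 0 ≤ t → Φ M₀ z₀ c₀ t ≤ Φ' M₀ z₀ c₀ t) :
    FamilyEnvelopeRefit 𝓘₀ 𝓘₁ τ κN Φ' := by
  intro M z c M₀ z₀ c₀ e t hz hcl hm ht hch
  obtain ⟨M₁, z₁, c₁, hI₁, hN, h₁⟩ := h M z c M₀ z₀ c₀ e t hz hcl hm ht hch
  exact ⟨M₁, z₁, c₁, hI₁, hN, by linarith [hle M₀ z₀ c₀ t ht]⟩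

/-- Auxiliary step (`anti near`). [formal bookkeeping] -/
theorem FamilyCertRefit.anti_near {𝓘₀ 𝓘₁ : (M₀ : ℕ) → (Fin M₀ → E3) → Fin M₀ → Prop} {κN κN' φ : ℝ} {Φ : (M₀ : ℕ) → (Fin M₀ → E3) → Fin M₀ → ℝ → ℝ}
    {T : (M₀ : ℕ) → (Fin M₀ → E3) → Fin M₀ → ℝ} (h : FamilyCertRefit 𝓘₀ 𝓘₁ κN' φ Φ T) (hle : κN ≤ κN') : FamilyCertRefit 𝓘₀ 𝓘₁ κN φ Φ T :=
  fun M₀ z₀ c₀ M₁ z₁ c₁ hI₀ hI₁ hN => h M₀ z₀ c₀ M₁ z₁ c₁ hI₀ hI₁ (hN.mono hle)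

/-- Auxiliary step (`anti families`). [formal bookkeeping] -/
theorem FamilyCertRefit.anti_families {𝓘₀ 𝓘₀' 𝓘₁ 𝓘₁' : (M₀ : ℕ) → (Fin M₀ → E3) → Fin M₀ → Prop} {κN φ : ℝ}
    {Φ : (M₀ : ℕ) → (Fin M₀ → E3) → Fin M₀ → ℝ → ℝ} {T : (M₀ : ℕ) → (Fin M₀ → E3) → Fin M₀ → ℝ} (h : FamilyCertRefit 𝓘₀' 𝓘₁' κN φ Φ T)
    (h₀ : FamilyLE 𝓘₀ 𝓘₀') (h₁ : FamilyLE 𝓘₁ 𝓘₁') : FamilyCertRefit 𝓘₀ 𝓘₁ κN φ Φ T :=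
  fun M₀ z₀ c₀ M₁ z₁ c₁ hI₀ hI₁ hN => h M₀ z₀ c₀ M₁ z₁ c₁ (h₀ M₀ z₀ c₀ hI₀) (h₁ M₁ z₁ c₁ hI₁) hN

/-- Auxiliary step (`of le`). [formal bookkeeping] -/
theorem FamilyCertRefit.of_le {𝓘₀ 𝓘₁ : (M₀ : ℕ) → (Fin M₀ → E3) → Fin M₀ → Prop} {κN φ φ' : ℝ} {Φ : (M₀ : ℕ) → (Fin M₀ → E3) → Fin M₀ → ℝ → ℝ}
    {T : (M₀ : ℕ) → (Fin M₀ → E3) → Fin M₀ → ℝ} (h : FamilyCertRefit 𝓘₀ 𝓘₁ κN φ Φ T) (hle : φ' ≤ φ) : FamilyCertRefit 𝓘₀ 𝓘₁ κN φ' Φ T :=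
  fun M₀ z₀ c₀ M₁ z₁ c₁ hI₀ hI₁ hN => hle.trans (h M₀ z₀ c₀ M₁ z₁ c₁ hI₀ hI₁ hN)

/-- ★★ THE THREE-BAND NODE (g50's cut, displayed): edge band by any engine, BRIDGE band `[η_E, η₂)`, soft residual from `η₂`. [formal bookkeeping] -/
theorem coreOff_of_edge_of_band_of_soft {r r₁ ρ ε ηE η₂ φ : ℝ} (hE : EdgeFarFloor r r₁ ρ ε ηE φ) (hB : BandFarFloor r r₁ ρ ε ηE η₂ φ)
    (hS : SoftFarFloor r r₁ ρ ε η₂ φ) : CoreOffTubeFloor r r₁ ρ ε φ :=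
  (coreOff_iff_edge_band_soft r r₁ ρ ε ηE η₂ φ).2 ⟨hE, hB, hS⟩

/-! ## §3. The pins: phase-aware level tables, the modulus `Φ₀`, the law `T₀`, the constants -/

/-- **`levelTable af bf cf ah bh ch`** — the PHASE-AWARE quadratic table in the level above the edge, `x := fitLevel z₀ c₀ − 1/20`:
`af + bf·x + cf·x²` if the instance's centre is fcc-good at (`1/8`, `3/2`), else `ah + bh·x + ch·x²`. -/
noncomputable def levelTable (af bf cf ah bh ch : ℝ) : (M₀ : ℕ) → (Fin M₀ → E3) → Fin M₀ → ℝ :=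
  fun _ z₀ c₀ => if FccGoodAtScale (1 / 8) (3 / 2) z₀ c₀ then af + bf * (fitLevel z₀ c₀ - 1 / 20) + cf * (fitLevel z₀ c₀ - 1 / 20) ^ 2
    else ah + bh * (fitLevel z₀ c₀ - 1 / 20) + ch * (fitLevel z₀ c₀ - 1 / 20) ^ 2

/-- **`pinnedModulus ℓ sw ℓx q B T`** — the four-column modulus with the columns as the census measures them: `ℓ(z₀)·t + sw(z₀) + q·t² + (ℓx(z₀)·T(z₀) + B)`
(roughness of the charted shell · force slack `sw = s·σ₁` · curvature · exterior at the law's amplitude plus second order).  It IS g51's `lsqxModulus` (below). -/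
noncomputable def pinnedModulus (ℓ sw ℓx : (M₀ : ℕ) → (Fin M₀ → E3) → Fin M₀ → ℝ) (q B : ℝ) (T : (M₀ : ℕ) → (Fin M₀ → E3) → Fin M₀ → ℝ) :
    (M₀ : ℕ) → (Fin M₀ → E3) → Fin M₀ → ℝ → ℝ :=
  fun M₀ z₀ c₀ t => ℓ M₀ z₀ c₀ * t + sw M₀ z₀ c₀ + q * t ^ 2 + (ℓx M₀ z₀ c₀ * T M₀ z₀ c₀ + B)

/-- Auxiliary step (`sigmaOne pos`). [formal bookkeeping] -/
theorem sigmaOne_pos : 0 < sigmaOne := by unfold sigmaOne; positivity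

/-- `pinnedModulus ℓ sw ℓx q B T = lsqxModulus ℓ (sw/σ₁) q (ℓx·T + B)`. [formal bookkeeping] -/
theorem pinnedModulus_eq_lsqx (ℓ sw ℓx : (M₀ : ℕ) → (Fin M₀ → E3) → Fin M₀ → ℝ) (q B : ℝ) (T : (M₀ : ℕ) → (Fin M₀ → E3) → Fin M₀ → ℝ) :
    pinnedModulus ℓ sw ℓx q B T = lsqxModulus ℓ (fun M₀ z₀ c₀ => sw M₀ z₀ c₀ / sigmaOne) (fun _ _ _ => q)
      (fun M₀ z₀ c₀ => ℓx M₀ z₀ c₀ * T M₀ z₀ c₀ + B) := by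
  funext M₀ z₀ c₀ t
  simp only [pinnedModulus, lsqxModulus, div_mul_cancel₀ _ sigmaOne_pos.ne']

/-- ★ THE ROOM LAW OF RECORD `T₀ := rootLaw 1 0 (3/10)`: `T₀(z₀) = windowRoom z₀ c₀ + (3/10)·σ₁` (`κ = 1`, no root term, rattle allowance `0.3σ₁ ≈ 3.24e-3`). -/
noncomputable def T0 : (M₀ : ℕ) → (Fin M₀ → E3) → Fin M₀ → ℝ := rootLaw 1 0 (3 / 10)

/-- Auxiliary step (`T0 eq`). [formal bookkeeping] -/
theorem T0_eq {M₀ : ℕ} (z₀ : Fin M₀ → E3) (c₀ : Fin M₀) : T0 M₀ z₀ c₀ = windowRoom z₀ c₀ + 3 / 10 * sigmaOne := by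
  simp [T0, rootLaw]

/-- THE TABLES OF LINE A (refit engine; affine-quotiented columns `g_na`, `w_na`; census TABLES52, ≥ 5 % headroom on `fitLevel ≤ 9/100`). -/
noncomputable def ell0 : (M₀ : ℕ) → (Fin M₀ → E3) → Fin M₀ → ℝ := levelTable (3 / 50) (53 / 40) (11 / 2) (93 / 2000) (7 / 10) (35 / 2)
/-- Pinned numerical constant `ellx0` of the refit engine (lens-5 g52). -/
noncomputable def ellx0 : (M₀ : ℕ) → (Fin M₀ → E3) → Fin M₀ → ℝ := levelTable (33 / 1000) (17 / 40) 11 (9 / 500) (2 / 5) 7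
/-- Pinned numerical constant `sw0` of the refit engine (lens-5 g52). -/
noncomputable def sw0 : (M₀ : ℕ) → (Fin M₀ → E3) → Fin M₀ → ℝ := levelTable (47 / 50000) (3 / 200) (3 / 20) (41 / 50000) (1 / 80) (1 / 4)

/-- THE TABLES OF LINE B (plain engine; raw columns `g`, `w`). -/
noncomputable def ell0' : (M₀ : ℕ) → (Fin M₀ → E3) → Fin M₀ → ℝ := levelTable (11 / 125) (37 / 20) (1 / 2) (11 / 125) (27 / 20) (25 / 2)
/-- Pinned numerical constant `ellx0'` of the refit engine (lens-5 g52). -/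
noncomputable def ellx0' : (M₀ : ℕ) → (Fin M₀ → E3) → Fin M₀ → ℝ := levelTable (27 / 500) (23 / 40) 13 (3 / 80) (7 / 8) 1
/-- Pinned numerical constant `sw0'` of the refit engine (lens-5 g52). -/
noncomputable def sw0' : (M₀ : ℕ) → (Fin M₀ → E3) → Fin M₀ → ℝ := levelTable (3 / 2500) (1 / 50) (1 / 10) (11 / 10000) (1 / 50) (1 / 5)

/-- ★ THE MODULI OF RECORD: `Φ₀` (LINE A) and `Φ₀'` (LINE B), curvature `q₀ = 1/4`, second-order exterior `B₀ = 1/10000`, exterior at the law `T₀`. -/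
noncomputable def Phi0 : (M₀ : ℕ) → (Fin M₀ → E3) → Fin M₀ → ℝ → ℝ := pinnedModulus ell0 sw0 ellx0 (1 / 4) (1 / 10000) T0
/-- Pinned numerical constant `Phi0'` of the refit engine (lens-5 g52). -/
noncomputable def Phi0' : (M₀ : ℕ) → (Fin M₀ → E3) → Fin M₀ → ℝ → ℝ := pinnedModulus ell0' sw0' ellx0' (1 / 4) (1 / 10000) T0

/-- The modulus of record unfolded at an hcp-charting instance of level `η` and deviation `t` (the formula the census certifies):
`Φ₀ = (93/2000 + (7/10)x + (35/2)x²)·t + (41/50000 + x/80 + x²/4) + t²/4 + ((9/500 + (2/5)x + 7x²)·(windowRoom + (3/10)σ₁) + 1/10000)`, `x = η − 1/20`. [formal bookkeeping] -/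
theorem Phi0_hcp {M₀ : ℕ} {z₀ : Fin M₀ → E3} {c₀ : Fin M₀} (h : ¬FccGoodAtScale (1 / 8) (3 / 2) z₀ c₀) (t : ℝ) :
    Phi0 M₀ z₀ c₀ t = (93 / 2000 + 7 / 10 * (fitLevel z₀ c₀ - 1 / 20) + 35 / 2 * (fitLevel z₀ c₀ - 1 / 20) ^ 2) * t
      + (41 / 50000 + 1 / 80 * (fitLevel z₀ c₀ - 1 / 20) + 1 / 4 * (fitLevel z₀ c₀ - 1 / 20) ^ 2) + 1 / 4 * t ^ 2
      + ((9 / 500 + 2 / 5 * (fitLevel z₀ c₀ - 1 / 20) + 7 * (fitLevel z₀ c₀ - 1 / 20) ^ 2) * (windowRoom z₀ c₀ + 3 / 10 * sigmaOne) + 1 / 10000) := by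
  simp only [Phi0, pinnedModulus, ell0, sw0, ellx0, levelTable, if_neg h, T0_eq]

/-- Auxiliary step (`Phi0 fcc`). [formal bookkeeping] -/
theorem Phi0_fcc {M₀ : ℕ} {z₀ : Fin M₀ → E3} {c₀ : Fin M₀} (h : FccGoodAtScale (1 / 8) (3 / 2) z₀ c₀) (t : ℝ) :
    Phi0 M₀ z₀ c₀ t = (3 / 50 + 53 / 40 * (fitLevel z₀ c₀ - 1 / 20) + 11 / 2 * (fitLevel z₀ c₀ - 1 / 20) ^ 2) * t
      + (47 / 50000 + 3 / 200 * (fitLevel z₀ c₀ - 1 / 20) + 3 / 20 * (fitLevel z₀ c₀ - 1 / 20) ^ 2) + 1 / 4 * t ^ 2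
      + ((33 / 1000 + 17 / 40 * (fitLevel z₀ c₀ - 1 / 20) + 11 * (fitLevel z₀ c₀ - 1 / 20) ^ 2) * (windowRoom z₀ c₀ + 3 / 10 * sigmaOne) + 1 / 10000) := by
  simp only [Phi0, pinnedModulus, ell0, sw0, ellx0, levelTable, if_pos h, T0_eq]

/-- THE CONSTANTS OF RECORD: coarse chart tolerance `τ₀ = 1/4`, refit constant `κN₀ = 1/4`; LINE A: chart family cap `η₀₀ = 1/16`, comparison family cap
`η₃₀ = 7/100`, edge level `η_E = 3/50`; LINE B: family cap `η₃₀' = 11/200`, edge level `η_E' = 21/400`. -/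
noncomputable def tau0 : ℝ := 1 / 4
/-- Pinned numerical constant `kN0` of the refit engine (lens-5 g52). -/
noncomputable def kN0 : ℝ := 1 / 4
/-- Pinned numerical constant `eta00` of the refit engine (lens-5 g52). -/
noncomputable def eta00 : ℝ := 1 / 16
/-- Pinned numerical constant `eta30` of the refit engine (lens-5 g52). -/
noncomputable def eta30 : ℝ := 7 / 100
/-- Pinned numerical constant `etaE` of the refit engine (lens-5 g52). -/
noncomputable def etaE : ℝ := 3 / 50
/-- Pinned numerical constant `eta30'` of the refit engine (lens-5 g52). -/
noncomputable def eta30' : ℝ := 11 / 200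
/-- Pinned numerical constant `etaE'` of the refit engine (lens-5 g52). -/
noncomputable def etaE' : ℝ := 21 / 400

/-- The chart family of LINE A sits inside its comparison family, and the homogeneous family inside both (`id ∈ 𝓑₀`). [formal bookkeeping] -/
theorem chartFamily_le_comparison0 : FamilyLE (bentFamily bends0 eta00) (bentFamily bends0 eta30) :=
  bentFamily_le subset_rfl (by norm_num [eta00, eta30])

/-! ## §4. The instantiated decls (F1/F2/F3)-bent₀ and the nodes of record -/

/-- ★ **(F1-bent₀) OF RECORD** `:= FamilyEnvelopeRefit (bentFamily 𝓑₀ (1/16)) (bentFamily 𝓑₀ (7/100)) (1/4) (1/4) Φ₀`. -/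
def FamilyEnvelopeBent0 : Prop := FamilyEnvelopeRefit (bentFamily bends0 eta00) (bentFamily bends0 eta30) tau0 kN0 Phi0

/-- ★ **(F2-bent₀) OF RECORD** `:= FamilyRoom (bentFamily 𝓑₀ (1/16)) (24/5) (1/100) (3/50) (1/4) T₀`. -/
def FamilyRoomBent0 : Prop := FamilyRoom (bentFamily bends0 eta00) (24 / 5) (1 / 100) etaE tau0 T0

/-- ★ **(F3-bent₀) OF RECORD** `:= FamilyCertRefit (bentFamily 𝓑₀ (1/16)) (bentFamily 𝓑₀ (7/100)) (1/4) 0 Φ₀ T₀`. -/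
def FamilyCertBent0 : Prop := FamilyCertRefit (bentFamily bends0 eta00) (bentFamily bends0 eta30) kN0 0 Phi0 T0

/-- **(F1-bent₀') LINE B** `:= FamilyEnvelope (bentFamily 𝓑₀ (11/200)) (1/4) Φ₀'` (g51's plain decl, raw tables). -/
def FamilyEnvelopeBent0' : Prop := FamilyEnvelope (bentFamily bends0 eta30') tau0 Phi0'

/-- **(F2-bent₀') LINE B** `:= FamilyRoom (bentFamily 𝓑₀ (11/200)) (24/5) (1/100) (21/400) (1/4) T₀`. -/
def FamilyRoomBent0' : Prop := FamilyRoom (bentFamily bends0 eta30') (24 / 5) (1 / 100) etaE' tau0 T0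

/-- **(F3-bent₀') LINE B** `:= FamilyCert (bentFamily 𝓑₀ (11/200)) 0 Φ₀' T₀`. -/
def FamilyCertBent0' : Prop := FamilyCert (bentFamily bends0 eta30') 0 Phi0' T0

/-- ★★ LINE A, EDGE BAND: (F1-bent₀) ∧ (F2-bent₀) ∧ (F3-bent₀) ⟹ `EdgeFarFloor (63/10) (63/10) (24/5) (1/100) (3/50) 0`. [folklore] -/
theorem edgeFar_bent0 (hE : FamilyEnvelopeBent0) (hR : FamilyRoomBent0) (hC : FamilyCertBent0) :
    EdgeFarFloor (63 / 10) (63 / 10) (24 / 5) (1 / 100) (3 / 50) 0 :=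
  edgeFar_of_familyRefit hE hR hC

/-- ★★ LINE A, NODE OF RECORD: edge band (engine) ∧ `BandFarFloor … (3/50) (1/10) 0` [BRIDGE] ∧ `SoftFarFloor … (1/10) 0` [SOFT-FAR, residual of record] ⟹
`CoreOffTubeFloor (63/10) (63/10) (24/5) (1/100) 0` [CORE-FAR]. [folklore] -/
theorem coreOff_record_bent0 (hE : FamilyEnvelopeBent0) (hR : FamilyRoomBent0) (hC : FamilyCertBent0)
    (hB : BandFarFloor (63 / 10) (63 / 10) (24 / 5) (1 / 100) (3 / 50) (1 / 10) 0) (hS : SoftFarFloor (63 / 10) (63 / 10) (24 / 5) (1 / 100) (1 / 10) 0) :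
    CoreOffTubeFloor (63 / 10) (63 / 10) (24 / 5) (1 / 100) 0 :=
  coreOff_of_edge_of_band_of_soft (edgeFar_bent0 hE hR hC) hB hS

/-- ★ LINE A without the bridge: the residual enlarged to `SoftFarFloor … (3/50) 0`. [folklore] -/
theorem coreOff_record_bent0_of_soft_etaE (hE : FamilyEnvelopeBent0) (hR : FamilyRoomBent0) (hC : FamilyCertBent0)
    (hS : SoftFarFloor (63 / 10) (63 / 10) (24 / 5) (1 / 100) (3 / 50) 0) : CoreOffTubeFloor (63 / 10) (63 / 10) (24 / 5) (1 / 100) 0 :=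
  coreOff_of_familyRefit_of_soft hE hR hC hS

/-- ★★ LINE A threaded through the tree's record assembly to the T-side piece (m = 1/625, μ_T = 1/1000, A = 3/5000):
`HomFloor (1/625) → TailPenalty (24/5) (1/1000) → CoreCoreRelief … (3/5000) → (F1-bent₀) → (F2-bent₀) → (F3-bent₀) → BandFarFloor … (3/50) (1/10) 0 →
SoftFarFloor … (1/10) 0 → AnnularPhaseFloor … (1/1000) → PolyTextureFloor … (1/1000) → AnnularDefectFloor (24/5) (63/10) → DefectiveCollarFloor (24/5) →
StrainedPatchRec`. -/
theorem strainedPatchRec_bent0 (hH : HomFloor (1 / 625)) (hT : TailPenalty (24 / 5) (1 / 1000))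
    (hRl : CoreCoreRelief (63 / 10) (63 / 10) (24 / 5) (1 / 100) (3 / 5000)) (hE : FamilyEnvelopeBent0) (hR : FamilyRoomBent0) (hC : FamilyCertBent0)
    (hB : BandFarFloor (63 / 10) (63 / 10) (24 / 5) (1 / 100) (3 / 50) (1 / 10) 0) (hS : SoftFarFloor (63 / 10) (63 / 10) (24 / 5) (1 / 100) (1 / 10) 0)
    (hF : AnnularPhaseFloor (63 / 10) (24 / 5) (63 / 10) (1 / 1000)) (hP : PolyTextureFloor (63 / 10) (24 / 5) (1 / 1000))
    (hA : AnnularDefectFloor (24 / 5) (63 / 10)) (hD : DefectiveCollarFloor (24 / 5)) : StrainedPatchRec :=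
  strainedPatchRec_of_homFloor_of_tailPenalty_of_coreRelief_of_coreOff_of_annularPhase_of_poly_of_annular_of_near (by norm_num) hH hT hRl
    seam_arith_core (coreOff_record_bent0 hE hR hC hB hS) hF hP le_rfl (by norm_num) (by norm_num) hA hD

/-- ★ LINE B, EDGE BAND: (F1-bent₀') ∧ (F2-bent₀') ∧ (F3-bent₀') ⟹ `EdgeFarFloor (63/10) (63/10) (24/5) (1/100) (21/400) 0`. [folklore] -/
theorem edgeFar_bent0' (hE : FamilyEnvelopeBent0') (hR : FamilyRoomBent0') (hC : FamilyCertBent0') :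
    EdgeFarFloor (63 / 10) (63 / 10) (24 / 5) (1 / 100) (21 / 400) 0 :=
  edgeFar_of_family hE hR hC

/-- ★ LINE B, NODE: edge band ∧ `BandFarFloor … (21/400) (1/10) 0` [BRIDGE, wider] ∧ [SOFT-FAR] ⟹ [CORE-FAR]. [folklore] -/
theorem coreOff_record_bent0' (hE : FamilyEnvelopeBent0') (hR : FamilyRoomBent0') (hC : FamilyCertBent0')
    (hB : BandFarFloor (63 / 10) (63 / 10) (24 / 5) (1 / 100) (21 / 400) (1 / 10) 0) (hS : SoftFarFloor (63 / 10) (63 / 10) (24 / 5) (1 / 100) (1 / 10) 0) :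
    CoreOffTubeFloor (63 / 10) (63 / 10) (24 / 5) (1 / 100) 0 :=
  coreOff_of_edge_of_band_of_soft (edgeFar_bent0' hE hR hC) hB hS

/-- The trades instantiated: g51's PLAIN envelope on the chart family of LINE A gives (F1-bent₀); (F3-bent₀) gives g51's PLAIN certificate on the chart family;
a HOMOGENEOUS room statement at (`1/16`, `3/50`, `T₀`) gives (F2-bent₀) (`id ∈ 𝓑₀`). [formal bookkeeping] -/
theorem familyEnvelopeBent0_of_plain (h : FamilyEnvelope (bentFamily bends0 eta00) tau0 Phi0) : FamilyEnvelopeBent0 :=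
  familyEnvelopeRefit_of_familyEnvelope chartFamily_le_comparison0 (by norm_num [kN0]) h

/-- Auxiliary step (`familyCert plain of bent0`). [formal bookkeeping] -/
theorem familyCert_plain_of_bent0 (h : FamilyCertBent0) : FamilyCert (bentFamily bends0 eta00) 0 Phi0 T0 :=
  familyCert_of_familyCertRefit chartFamily_le_comparison0 (by norm_num [kN0]) h

/-- Auxiliary step (`familyRoomBent0 of hom`). [formal bookkeeping] -/
theorem familyRoomBent0_of_hom (h : FamilyRoom (homFamily eta00) (24 / 5) (1 / 100) etaE tau0 T0) : FamilyRoomBent0 :=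
  familyRoom_bent_of_hom id_mem_bends0 h

end Summit.AtomisticToContinuum.Crystallization.Theorems.FrustratedLawDichotomyStrainedPatchChartFamiliesPinned
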